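import Mathlib
import Summits.Langlands.Langlands.Theses.PicardMuOrdinary
import Literature.NumberTheory.GaloisRepresentations.GaloisRep
import Literature.NumberTheory.Automorphic.ReciprocityGLnProofs
import Literature.NumberTheory.Automorphic.AsaiSign
import Literature.NumberTheory.Automorphic.BaseChangeCyclicCuspidal
import Literature.NumberTheory.Automorphic.BaseChangeStrongUnramified
import Literature.NumberTheory.Automorphic.BaseChangeArchimedean
import Literature.NumberTheory.Automorphic.GLnAdelicStructureProofs
import Summits.Langlands.Langlands.Theorems.PicardMuOrdinaryIrregularClassicalityBaseChangeToLField
import Summits.Langlands.Langlands.Theorems.PicardMuOrdinaryIrregularClassicalityBaseChangeToLTower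
import Summits.Langlands.Langlands.Theorems.PicardMuOrdinaryIrregularClassicalityBaseChangeToL
import HarnessLib

/-!
# Stub `stub_baseChangeToL` of line `split-ramified-prime-sqrt6`, LINKED form (reshape r9): the base
# change `L = K(√-2)` as a MAP on tower members — every member `(P, r)` goes to an unramified strong lift
# `P_L` of `P`, Galois-compatible with `r|_{Γ_L}`

Crux `Summit.Langlands.Langlands.Theses.PicardMuOrdinary.IrregularClassicality` (stmt-Langlands-13758),
line `split-ramified-prime-sqrt6`.  `K = ℚ(ω) = CyclotomicField 3 ℚ`, `ℚ̄₃ = PadicAlgCl 3`.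

The r5 form of Stub 4 (`stub_baseChangeToL`, `𝔐`-currency, no avatars, four named facts) and the r8
avatar form (`stub_baseChangeToL_ord`, three Arthur–Clozel facts) both return the `L`-side tower behind
an `∃`: for every `k` SOME regular algebraic conjugate-self-dual cuspidal `Π_k` on `GL₃(𝔸_L)` with SOME
compatible `r`, converging to `ρ|_{Γ_L}`.  The heart of the line consumes the `K`-side ORDINARY tower
and the `L`-side tower as two separate hypotheses, and the LINK between them — `Π_k` is the base change
of the `k`-th ordinary member `P_k`, and its Galois representation is the restriction `r_k|_{Γ_L}` of the
ordinary avatar — was lost, although it is exactly what step (i) of the heart's intended proof uses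
("the `Π_k` are μ-ordinary of finite level at `u, ū ∣ 3` BY THE AVATARS": `L_u = K_λ`, so
`r_k|_{Γ_{L_u}} = r_k|_{Γ_{K_λ}}` is ordinary, and local–global compatibility at `p` transfers this to
`Π_k`).  This file lands the base change in LINKED form, as a map on members:

`stub_baseChangeToL_linked`: from the three Arthur–Clozel facts, for `ι`, a level datum, `c₀ ≠ 1`,
finite sets `S, S₀ ⊇ {v ∣ 3}` of places of `K`, a trace function `a` and a framed `ρ` with
geometric-Frobenius traces `ι⁻¹(a 𝔭)` off `S₀`, there are the CM field `L = K[X]/(X² + 2)` (`s = √-2`,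
involution `c` with `c s = -s`, `c|_K = c₀`, `[L : K] = 2`; `exists_cmField_sqrt_neg_two`), a level
datum `hcptL` and ONE finite set `S_L` of places of `L` containing the places over `3`, over `S₀` and over
`S`, such that FOR EVERY `k` AND EVERY member `(P, r)` of depth `k` — `P` cuspidal regular algebraic
`c₀`-conjugate-self-dual, `r` framed, Galois-compatible with `P` off `S`,
`‖ι⁻¹(N𝔭·ΣSat(P,𝔭) − a 𝔭)‖ ≤ 3^{-k}` off `S` — there is a cuspidal `P_L` on `GL₃(𝔸_L)` which is regular
algebraic, `c`-conjugate-self-dual, an UNRAMIFIED STRONG BASE-CHANGE LIFT of `P`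
(`IsUnramifiedBaseChangeLift P P_L`: `Sat(P_L, w) = Sat(P, v)^{f(w|v)}` wherever `v` is unramified in
`L` and `P` is unramified at `v`), unramified and Galois-compatible with `r|_{Γ_L}` off `S_L`, and
`‖tr r|_{Γ_L} − tr ρ|_{Γ_L}‖ ≤ 3^{-k}` on all of `Γ_L`.

Proof (`member_baseChange`, for any quadratic `E/F` with compatible involutions): the level
`S_E := {w : w ∩ 𝓞 F ∈ S ∪ S₀ ∪ Ram(E/F)}` depends only on `(S, S₀)`; for a member `(P, r)`: an inert
good place with `-α ≠ α` (odd rank, `exists_inert_hasSatakeParamAt`) makes `BC_{E/F}(P)` cuspidal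
(`baseChange_cyclic_cuspidal`); it is an unramified strong lift
(`ArthurClozel1989_strongLifting_unramified`), hence regular algebraic
(`ArthurClozel1989_strongLifting_archimedean`), unramified off `S_E`, conjugate self-dual for `c`
(`isConjSelfDualAE_of_isUnramifiedBaseChangeLift`), compatible with `r|_{Γ_E}` off `S_E`
(`isGaloisCompatibleAt_restrictField`); the trace bound holds on `Γ_F` by Chebotarev density of the
Frobenii off `S ∪ S₀` (`norm_trace_sub_le_of_frobenius`) and restricts to `Γ_E`.  Same mathematics as
the landed `tower_baseChange` / `tower_baseChange_ord`; only the quantifier structure differs.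

References: J. Arthur, L. Clozel, Ann. of Math. Stud. 120 (1989), Ch. 3, Thm. 4.2 (a), Thm. 5.1;
J.-P. Serre, *Abelian ℓ-adic representations* (1968), Ch. I §2.2.
-/

open scoped MatrixGroups Classical
open Literature.NumberTheory.GaloisRepresentations Literature.NumberTheory.Automorphic
open IsDedekindDomain NumberField Polynomial Filter

set_option linter.dupNamespace false -- project-wide: `Summit.Langlands.Langlands` is the mandated namespace

noncomputable section

namespace Summit.Langlands.Langlands.Theorems.IrregularClassicality.SplitRamifiedPrimeSqrt6

/-! ## The base change of ONE member along a quadratic extension, over a member-independent level -/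

/-- **The member-independent level over `E`**: for finite sets `S, S₀` of places of `F` there is a
finite set `S_E` of places of `E` containing the places over `3` (if `S₀` does), over `S₀` and over `S`,
outside which every place lies over a place `v ∉ S ∪ S₀` unramified in `E`. [folklore] -/
theorem exists_level_baseChange {F E : Type} [Field F] [NumberField F] [Field E] [NumberField E]
    [Algebra F E] [FiniteDimensional F E]
    (S S₀ : Finset (HeightOneSpectrum (𝓞 F)))
    (hS₀ : ∀ v : HeightOneSpectrum (𝓞 F), ((3 : ℕ) : 𝓞 F) ∈ v.asIdeal → v ∈ S₀) :
    ∃ S_E : Finset (HeightOneSpectrum (𝓞 E)),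
      (∀ w : HeightOneSpectrum (𝓞 E), ((3 : ℕ) : 𝓞 E) ∈ w.asIdeal → w ∈ S_E) ∧
      (∀ w : HeightOneSpectrum (𝓞 E), w.under (𝓞 F) ∈ S₀ → w ∈ S_E) ∧
      (∀ w : HeightOneSpectrum (𝓞 E), w.under (𝓞 F) ∈ S → w ∈ S_E) ∧
      ∀ w : HeightOneSpectrum (𝓞 E), w ∉ S_E →
        w.under (𝓞 F) ∉ S ∧ w.under (𝓞 F) ∉ S₀ ∧
          Algebra.IsUnramifiedIn (𝓞 E) (w.under (𝓞 F)).asIdeal := by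
  have hfinR : {v : HeightOneSpectrum (𝓞 F) | ¬ Algebra.IsUnramifiedIn (𝓞 E) v.asIdeal}.Finite :=
    finite_setOf_not_isUnramifiedIn F E
  set T : Finset (HeightOneSpectrum (𝓞 F)) := S ∪ S₀ ∪ hfinR.toFinset with hT
  have hfinE : {w : HeightOneSpectrum (𝓞 E) | w.under (𝓞 F) ∈ T}.Finite := by
    refine (Set.Finite.biUnion T.finite_toSet fun v _ => finite_setOf_under_eq (M := E) v).subset ?_
    intro w hw
    exact Set.mem_biUnion hw rfl
  have h3under : ∀ w : HeightOneSpectrum (𝓞 E), ((3 : ℕ) : 𝓞 E) ∈ w.asIdeal →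
      ((3 : ℕ) : 𝓞 F) ∈ (w.under (𝓞 F)).asIdeal := fun w hw => by
    rw [HeightOneSpectrum.under_asIdeal, Ideal.under, Ideal.mem_comap, map_natCast]
    exact hw
  refine ⟨hfinE.toFinset, fun w hw => ?_, fun w hw => ?_, fun w hw => ?_, fun w hw => ?_⟩
  · rw [Set.Finite.mem_toFinset, Set.mem_setOf_eq, hT, Finset.mem_union, Finset.mem_union]
    exact Or.inl (Or.inr (hS₀ _ (h3under w hw)))
  · rw [Set.Finite.mem_toFinset, Set.mem_setOf_eq, hT, Finset.mem_union, Finset.mem_union]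
    exact Or.inl (Or.inr hw)
  · rw [Set.Finite.mem_toFinset, Set.mem_setOf_eq, hT, Finset.mem_union, Finset.mem_union]
    exact Or.inl (Or.inl hw)
  · simp only [Set.Finite.mem_toFinset, Set.mem_setOf_eq, hT, Finset.mem_union, not_or,
      not_not] at hw
    exact ⟨hw.1.1, hw.1.2, hw.2⟩

/-- **Base change of ONE member of a polarized congruence tower with its avatar**, along a quadratic
`E/F` with compatible involutions `c|_F = c₀`, over the member-independent level of
`exists_level_baseChange`: a cuspidal regular algebraic `c₀`-conjugate-self-dual `P` on `GL₃(𝔸_F)` with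
a framed `r` Galois-compatible with `P` off `S` and `‖ι⁻¹(N𝔭·ΣSat(P,𝔭) − a 𝔭)‖ ≤ 3^{-k}` off `S` has a
cuspidal base change `P_E` — regular algebraic, `c`-conjugate-self-dual, an unramified strong lift of
`P`, unramified and Galois-compatible with `r|_{Γ_E}` off `S_E` — and `‖tr r|_{Γ_E} − tr ρ|_{Γ_E}‖ ≤ 3^{-k}`
on `Γ_E` for every framed `ρ` with geometric-Frobenius traces `ι⁻¹(a 𝔭)` off `S₀`.  From the three
Arthur–Clozel facts; see the module docstring. -/
theorem member_baseChange (h₁ : baseChange_cyclic_cuspidal)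
    (h₂ : ArthurClozel1989_strongLifting_unramified) (h₃ : ArthurClozel1989_strongLifting_archimedean)
    {F E : Type} [Field F] [NumberField F] [Field E] [NumberField E] [Algebra F E]
    (h2 : Module.finrank F E = 2)
    {c : E ≃ₐ[ℚ] E} {c₀ : F ≃ₐ[ℚ] F} (hcc₀ : ∀ x : F, c (algebraMap F E x) = algebraMap F E (c₀ x))
    (ι : PadicAlgCl 3 ≃+* ℂ)
    {hcpt : isCompact_glFiniteIntegralLevel 3 F} (hcptE : isCompact_glFiniteIntegralLevel 3 E)
    {S S₀ : Finset (HeightOneSpectrum (𝓞 F))} {a : HeightOneSpectrum (𝓞 F) → ℂ}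
    {ρ : FramedGaloisRep F (PadicAlgCl 3) 3}
    (hρ : ∀ 𝔭 ∉ S₀, ρ.IsUnramifiedAt 𝔭 ∧
      ∀ 𝔓 ∈ 𝔭.primesAbove, ∀ τ : Field.absoluteGaloisGroup F,
        IsArithFrobAt (𝓞 F) τ 𝔓 → FramedRep.trace ρ τ⁻¹ = ι.symm (a 𝔭))
    {S_E : Finset (HeightOneSpectrum (𝓞 E))}
    (hS_E : ∀ w : HeightOneSpectrum (𝓞 E), w ∉ S_E →
      w.under (𝓞 F) ∉ S ∧ w.under (𝓞 F) ∉ S₀ ∧ Algebra.IsUnramifiedIn (𝓞 E) (w.under (𝓞 F)).asIdeal)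
    {k : ℕ} {P : CuspidalAutomorphicRepData 3 F hcpt} {r : FramedGaloisRep F (PadicAlgCl 3) 3}
    (hPreg : P.1.IsRegularAlgebraic) (hPcsd : P.1.IsConjSelfDualAE c₀)
    (hPS : ∀ 𝔭 ∉ S, IsGaloisCompatibleAt P.1 ι r 𝔭 ∧
      ∃ (α : Multiset ℂ) (t : integralClosure ℤ ℂ), P.1.HasSatakeParamAt 𝔭 α ∧
        (t : ℂ) = (𝔭.residueCard : ℂ) * α.sum - a 𝔭 ∧ ‖ι.symm (t : ℂ)‖ ≤ ((3 : ℝ)⁻¹) ^ k) :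
    ∃ P_E : CuspidalAutomorphicRepData 3 E hcptE,
      P_E.1.IsRegularAlgebraic ∧ P_E.1.IsConjSelfDualAE c ∧ IsUnramifiedBaseChangeLift P.1 P_E.1 ∧
      (∀ w ∉ S_E, P_E.1.IsUnramifiedAt w ∧ IsGaloisCompatibleAt P_E.1 ι (r.restrictField E) w) ∧
      ∀ g : Field.absoluteGaloisGroup E,
        ‖FramedRep.trace (r.restrictField E) g - FramedRep.trace (ρ.restrictField E) g‖ ≤
          ((3 : ℝ)⁻¹) ^ k := by
  haveI : FiniteDimensional F E := Module.finite_of_finrank_eq_succ h2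
  haveI : Algebra.IsQuadraticExtension F E := ⟨h2⟩
  haveI : IsGalois F E := inferInstance
  have hprime : (Module.finrank F E).Prime := by rw [h2]; exact Nat.prime_two
  -- the cuspidal base change of `P`
  obtain ⟨v₁, w₁, α₁, hw₁, hf₁, hα₁, hne₁⟩ := exists_inert_hasSatakeParamAt h2 (by decide) P.1
  obtain ⟨BC, hBC⟩ := h₁ 3 F E hprime hcpt P ⟨v₁, w₁, α₁, hw₁, hf₁, hα₁, hne₁⟩ hcptE
  have hU : IsUnramifiedBaseChangeLift P.1 BC.1 := h₂.isUnramifiedBaseChangeLift hprime hBC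
  have hBCreg : BC.1.IsRegularAlgebraic := hU.isRegularAlgebraic h₃ hprime hPreg
  refine ⟨BC, hBCreg, isConjSelfDualAE_of_isUnramifiedBaseChangeLift hU hcc₀ hPcsd, hU,
    fun w hw => ?_, fun g => ?_⟩
  · -- unramifiedness and compatibility at `w ∉ S_E`
    obtain ⟨hwS, -, hwu⟩ := hS_E w hw
    obtain ⟨hcompat, α, -, hα, -⟩ := hPS _ hwS
    refine ⟨hU.isUnramifiedAt (v := w.under (𝓞 F)) rfl hwu ⟨α, hα⟩, ?_⟩
    exact isGaloisCompatibleAt_restrictField P.1 BC.1 ι r (v := w.under (𝓞 F)) rfl hα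
      (hU w (w.under (𝓞 F)) α rfl hwu hα) fun β hβ => hcompat β hβ
  · -- the sup-norm bound, over `Γ_F` by density of the Frobenii off `S ∪ S₀`, then on `Γ_E`
    have hF : ∀ g : Field.absoluteGaloisGroup F,
        ‖FramedRep.trace r g - FramedRep.trace ρ g‖ ≤ ((3 : ℝ)⁻¹) ^ k := by
      refine norm_trace_sub_le_of_frobenius (↑(S ∪ S₀) : Set (HeightOneSpectrum (𝓞 F)))
        (S ∪ S₀).finite_toSet r ρ _ fun v hv 𝔓 h𝔓 σ hσ => ?_
      simp only [Finset.coe_union, Set.mem_union, Finset.mem_coe, not_or] at hv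
      obtain ⟨hvS, hvS₀⟩ := hv
      obtain ⟨hcompat, α, t, hα, ht, hnorm⟩ := hPS v hvS
      rw [trace_inv_eq_of_isGaloisCompatibleAt ι hcompat hα h𝔓 hσ,
        (hρ v hvS₀).2 𝔓 h𝔓 σ hσ, ← map_sub, ← ht]
      exact hnorm
    exact hF (absGaloisRestrict F E g)

/-! ## The stub, linked form, conditionally on the three Arthur–Clozel facts -/

/-- **Stub 4 of the line `split-ramified-prime-sqrt6` in LINKED form (`stub_baseChangeToL_linked`,
reshape r9), CONDITIONAL on the three named facts** `baseChange_cyclic_cuspidal`,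
`ArthurClozel1989_strongLifting_unramified`, `ArthurClozel1989_strongLifting_archimedean`: the base
change to `L = K(√-2)` as a MAP on tower members.  The data `(L, s, c, hcptL, S_L)` depend only on
`(c₀, S, S₀)`; then every depth-`k` member `(P, r)` — `P` regular algebraic `c₀`-conjugate-self-dual
cuspidal on `GL₃(𝔸_K)`, `r` framed, Galois-compatible with `P` off `S`,
`‖ι⁻¹(N𝔭·ΣSat(P,𝔭) − a 𝔭)‖ ≤ 3^{-k}` off `S` — has an unramified strong base-change lift `P_L`
(regular algebraic, `c`-conjugate-self-dual, cuspidal), unramified and Galois-compatible with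
`r|_{Γ_L}` off `S_L`, with `‖tr r|_{Γ_L} − tr ρ|_{Γ_L}‖ ≤ 3^{-k}` on `Γ_L`.  This is the shape the
LINKED heart of reshape r9 consumes; it implies the r8 form `stub_baseChangeToL_ord` (apply it to the
members of a given tower). -/
theorem stub_baseChangeToL_linked :
    baseChange_cyclic_cuspidal → ArthurClozel1989_strongLifting_unramified →
    ArthurClozel1989_strongLifting_archimedean →
    ∀ (ι : PadicAlgCl 3 ≃+* ℂ) (hcpt : isCompact_glFiniteIntegralLevel 3 (CyclotomicField 3 ℚ))
      (c₀ : CyclotomicField 3 ℚ ≃ₐ[ℚ] CyclotomicField 3 ℚ), c₀ ≠ 1 →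
    ∀ (S S₀ : Finset (HeightOneSpectrum (𝓞 (CyclotomicField 3 ℚ))))
      (a : HeightOneSpectrum (𝓞 (CyclotomicField 3 ℚ)) → ℂ)
      (ρ : FramedGaloisRep (CyclotomicField 3 ℚ) (PadicAlgCl 3) 3),
      (∀ v : HeightOneSpectrum (𝓞 (CyclotomicField 3 ℚ)),
        ((3 : ℕ) : 𝓞 (CyclotomicField 3 ℚ)) ∈ v.asIdeal → v ∈ S₀) →
      (∀ 𝔭 ∉ S₀, ρ.IsUnramifiedAt 𝔭 ∧
        ∀ 𝔓 ∈ 𝔭.primesAbove, ∀ τ : Field.absoluteGaloisGroup (CyclotomicField 3 ℚ),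
          IsArithFrobAt (𝓞 (CyclotomicField 3 ℚ)) τ 𝔓 → FramedRep.trace ρ τ⁻¹ = ι.symm (a 𝔭)) →
    ∃ (L : Type) (_ : Field L) (_ : NumberField L) (_ : Algebra (CyclotomicField 3 ℚ) L)
      (s : L) (c : L ≃ₐ[ℚ] L) (hcptL : isCompact_glFiniteIntegralLevel 3 L)
      (S_L : Finset (HeightOneSpectrum (𝓞 L))),
      NumberField.IsCMField L ∧ s ^ 2 = -2 ∧ Module.finrank (CyclotomicField 3 ℚ) L = 2 ∧
      c s = -s ∧
      (∀ x : CyclotomicField 3 ℚ,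
        c (algebraMap (CyclotomicField 3 ℚ) L x) = algebraMap (CyclotomicField 3 ℚ) L (c₀ x)) ∧
      (∀ w : HeightOneSpectrum (𝓞 L), ((3 : ℕ) : 𝓞 L) ∈ w.asIdeal → w ∈ S_L) ∧
      (∀ w : HeightOneSpectrum (𝓞 L), w.under (𝓞 (CyclotomicField 3 ℚ)) ∈ S₀ → w ∈ S_L) ∧
      (∀ w : HeightOneSpectrum (𝓞 L), w.under (𝓞 (CyclotomicField 3 ℚ)) ∈ S → w ∈ S_L) ∧
      ∀ (k : ℕ) (P : CuspidalAutomorphicRepData 3 (CyclotomicField 3 ℚ) hcpt)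
        (r : FramedGaloisRep (CyclotomicField 3 ℚ) (PadicAlgCl 3) 3),
        P.1.IsRegularAlgebraic → P.1.IsConjSelfDualAE c₀ →
        (∀ 𝔭 ∉ S, IsGaloisCompatibleAt P.1 ι r 𝔭 ∧
          ∃ (α : Multiset ℂ) (t : integralClosure ℤ ℂ), P.1.HasSatakeParamAt 𝔭 α ∧
            (t : ℂ) = (𝔭.residueCard : ℂ) * α.sum - a 𝔭 ∧ ‖ι.symm (t : ℂ)‖ ≤ ((3 : ℝ)⁻¹) ^ k) →
        ∃ P_L : CuspidalAutomorphicRepData 3 L hcptL,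
          P_L.1.IsRegularAlgebraic ∧ P_L.1.IsConjSelfDualAE c ∧
          IsUnramifiedBaseChangeLift P.1 P_L.1 ∧
          (∀ w ∉ S_L, P_L.1.IsUnramifiedAt w ∧ IsGaloisCompatibleAt P_L.1 ι (r.restrictField L) w) ∧
          ∀ g : Field.absoluteGaloisGroup L,
            ‖FramedRep.trace (r.restrictField L) g - FramedRep.trace (ρ.restrictField L) g‖ ≤
              ((3 : ℝ)⁻¹) ^ k := by
  intro h₁ h₂ h₃ ι hcpt c₀ hc₀ S S₀ a ρ hS₀ hρ
  obtain ⟨L, _, _, _, s, c, hCM, hs, h2, hcs, hcc₀⟩ := exists_cmField_sqrt_neg_two c₀ hc₀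
  haveI : FiniteDimensional (CyclotomicField 3 ℚ) L := Module.finite_of_finrank_eq_succ h2
  obtain ⟨S_L, hSL3, hSLS₀, hSLS, hout⟩ :=
    exists_level_baseChange (F := CyclotomicField 3 ℚ) (E := L) S S₀ hS₀
  refine ⟨L, inferInstance, inferInstance, inferInstance, s, c, isCompact_glFiniteIntegralLevel_holds 3 L,
    S_L, hCM, hs, h2, hcs, hcc₀, hSL3, hSLS₀, hSLS, fun k P r hreg hcsd hP => ?_⟩
  exact member_baseChange h₁ h₂ h₃ h2 hcc₀ ι (isCompact_glFiniteIntegralLevel_holds 3 L) hρ hout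
    hreg hcsd hP

end Summit.Langlands.Langlands.Theorems.IrregularClassicality.SplitRamifiedPrimeSqrt6

end
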